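import Mathlib

/-!
# Arithmetic-progression digit designs of `cw₂^{⊠N}` need groups of order at least `4^N`

By the rigidity theorem (`SoloInformedCwTwoGroupRigidity`: `exists_digits_of_realizes`), a group
realization of the support `S_N` of the `N`-th Kronecker power of the small Coppersmith–Winograd
tensor `cw₂ ≅ Σ_{σ∈S₃} e_{σ0}⊗e_{σ1}⊗e_{σ2}` lives in an abelian group `B` and is *digital*:
additively, the three index maps are translates of `u ↦ P u := Σ_k f_k (u_k)` for digit maps
`f_k : Fin 3 → B`, `f_k 0 = 0`, and the relevant equation is `P u + P v + P w = σ := Σ_k (f_k 1 + f_k 2)`.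
A *weighted* realization (a monomial degeneration `T_B ⊵ cw₂^{⊠N}`, which gives the border-rank
bound `R̲(cw₂^{⊠N}) ≤ |B|`) is a system of real weights on the three index sets that is `≥ 0` on
the solutions of that equation with equality exactly on `S_N`; by the same rigidity theorem applied
to the group `(ℝ,+)` the weights are digital too, i.e. of the form `Σ_k α_k(u_k)` with `α_k 0 = 0`,
and the condition becomes: for all words `u v w` with `P u + P v + P w = σ` and SOME coordinate `k`
at which `u_k, v_k, w_k` are not pairwise distinct,
`0 < Σ_k (α_k u_k + α_k v_k + α_k w_k − α_k 1 − α_k 2)`   (hypothesis `H` below).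

**Theorem (new here; soloist door D6, partial no-go (b)).**  If the digits are ARITHMETIC
PROGRESSIONS, `f_k t = t • λ_k`, then for every weighted realization the map
`c ↦ Σ_k c_k • λ_k` is injective on `{0,1,2,3}^N` (`apDigits_injective`); hence `4^N ≤ |B|`
(`four_pow_le_card_of_apDigits`).  In particular the base-`4` construction in `ℤ/4^N`
(Alman–Vassilevska Williams, arXiv:1810.08671, Thm. 7.2 for `N = 1`) is optimal among AP designs
in every finite abelian group, and AP designs can never certify `R̲(cw₂^{⊠N}) < 4^N`.

Proof: the complement symmetry `t ↦ 2 − t` of `Fin 3` preserves the equation and `S_N`, so the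
symmetrised weights `γ_k t = α_k t + α_k (2−t) − α_k 2 = (0, w_k, 0)` are again admissible, with
`w_k > 0` (test the triple that is `(0,1,2)` off `k` and `(1,1,1)` at `k`).  If `Σ c_k•λ_k = Σ c'_k•λ_k`
with `c ≠ c'`, put `d = c − c' ∈ [−3,3]^N` and choose at each coordinate the pattern
`−3 ↦ 000, −2 ↦ 001, −1 ↦ 002, 0 ↦ 012, 1 ↦ 022, 2 ↦ 122, 3 ↦ 222` (letter sum `3 + d_k`, at most one
letter `1`): the resulting triple solves the equation, is off `S_N`, and has `γ`-excess `≤ 0`.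

No `sorry`; axioms `propext`, `Classical.choice`, `Quot.sound`.
-/

namespace Summit.MatrixMultiplication.MatrixMultiplication.Theorems

open Finset

section CwTwoAPDigits

variable {B : Type*} [AddCommGroup B] {N : ℕ}

/-- The complement involution of `Fin 3` on values: `rev t = 2 - t`. -/
theorem fin3_rev_val_int (t : Fin 3) : ((Fin.rev t).val : ℤ) = 2 - (t.val : ℤ) := by
  fin_cases t <;> rfl

/-- The pattern attached to a difference `d ∈ [-3,3]`: letter sum `3 + d`, at most one letter `1`,
and not a permutation of `(0,1,2)` unless `d = 0`. -/
def apPat (d : ℤ) : Fin 3 × Fin 3 × Fin 3 :=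
  if d = -3 then (0, 0, 0) else if d = -2 then (0, 0, 1) else if d = -1 then (0, 0, 2)
  else if d = 0 then (0, 1, 2) else if d = 1 then (0, 2, 2) else if d = 2 then (1, 2, 2)
  else (2, 2, 2)

/-- The letters of `apPat d` sum to `3 + d` for `d ∈ [-3,3]`. -/
theorem apPat_sum (d : ℤ) (hd : -3 ≤ d) (hd' : d ≤ 3) :
    (((apPat d).1.val : ℤ) + (apPat d).2.1.val + (apPat d).2.2.val) = 3 + d := by
  interval_cases d <;> simp [apPat]

/-- For `d ≠ 0` the pattern `apPat d` is not a permutation of `(0,1,2)`. -/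
theorem apPat_not_distinct (d : ℤ) (hd0 : d ≠ 0) :
    (apPat d).1 = (apPat d).2.1 ∨ (apPat d).2.1 = (apPat d).2.2 ∨ (apPat d).1 = (apPat d).2.2 := by
  unfold apPat
  split_ifs <;> simp_all

/-- With symmetric weights `(0, w, 0)`, `w > 0`, every pattern `apPat d` has excess `≤ 0`. -/
theorem apPat_excess_nonpos (d : ℤ) (γ : Fin 3 → ℝ) (h0 : γ 0 = 0) (h2 : γ 2 = 0)
    (h1 : 0 < γ 1) :
    γ (apPat d).1 + γ (apPat d).2.1 + γ (apPat d).2.2 - (γ 1 + γ 2) ≤ 0 := by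
  unfold apPat
  split_ifs <;> simp [h0, h2] <;> linarith

/-- **AP digit designs are `4^N`-injective.**  See the module docstring. -/
theorem apDigits_injective (lam : Fin N → B) (α : Fin N → Fin 3 → ℝ) (hα : ∀ k, α k 0 = 0)
    (H : ∀ u v w : Fin N → Fin 3,
      (∑ k, (((u k).val : ℤ) + (v k).val + (w k).val) • lam k) = ∑ k, (3 : ℤ) • lam k →
      (∃ k, u k = v k ∨ v k = w k ∨ u k = w k) →
      0 < ∑ k, (α k (u k) + α k (v k) + α k (w k) - (α k 1 + α k 2))) :
    Function.Injective (fun c : Fin N → Fin 4 => ∑ k, ((c k).val : ℤ) • lam k) := by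
  classical
  have hrev1 : Fin.rev (1 : Fin 3) = 1 := by decide
  have hrev2 : Fin.rev (2 : Fin 3) = 0 := by decide
  -- Step A: symmetrised weights are admissible.
  set γ : Fin N → Fin 3 → ℝ := fun k t => α k t + α k (Fin.rev t) - α k 2 with hγ
  have hγ0 : ∀ k, γ k 0 = 0 := by
    intro k; simp only [hγ]; rw [show Fin.rev (0 : Fin 3) = 2 by decide, hα k]; ring
  have hγ2 : ∀ k, γ k 2 = 0 := by
    intro k; simp only [hγ, hrev2, hα k]; ring
  have H' : ∀ u v w : Fin N → Fin 3,
      (∑ k, (((u k).val : ℤ) + (v k).val + (w k).val) • lam k) = ∑ k, (3 : ℤ) • lam k →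
      (∃ k, u k = v k ∨ v k = w k ∨ u k = w k) →
      0 < ∑ k, (γ k (u k) + γ k (v k) + γ k (w k) - (γ k 1 + γ k 2)) := by
    intro u v w hyp hns
    have h1 := H u v w hyp hns
    have hyp' : (∑ k, (((Fin.rev (u k)).val : ℤ) + (Fin.rev (v k)).val + (Fin.rev (w k)).val)
        • lam k) = ∑ k, (3 : ℤ) • lam k := by
      have step : ∀ k, (((Fin.rev (u k)).val : ℤ) + (Fin.rev (v k)).val + (Fin.rev (w k)).val)
          • lam k = (6 : ℤ) • lam k - (((u k).val : ℤ) + (v k).val + (w k).val) • lam k := by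
        intro k
        rw [fin3_rev_val_int, fin3_rev_val_int, fin3_rev_val_int, ← sub_smul]
        congr 1; ring
      rw [Finset.sum_congr rfl (fun k _ => step k), Finset.sum_sub_distrib, hyp,
        ← Finset.sum_sub_distrib]
      refine Finset.sum_congr rfl (fun k _ => ?_)
      rw [← sub_smul]; norm_num
    have hns' : ∃ k, Fin.rev (u k) = Fin.rev (v k) ∨ Fin.rev (v k) = Fin.rev (w k) ∨
        Fin.rev (u k) = Fin.rev (w k) := by
      obtain ⟨k, hk⟩ := hns
      exact ⟨k, by simpa only [Fin.rev_inj] using hk⟩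
    have h2 := H (fun k => Fin.rev (u k)) (fun k => Fin.rev (v k)) (fun k => Fin.rev (w k))
      hyp' hns'
    have hsum : (∑ k, (γ k (u k) + γ k (v k) + γ k (w k) - (γ k 1 + γ k 2))) =
        (∑ k, (α k (u k) + α k (v k) + α k (w k) - (α k 1 + α k 2))) +
        ∑ k, (α k (Fin.rev (u k)) + α k (Fin.rev (v k)) + α k (Fin.rev (w k)) -
          (α k 1 + α k 2)) := by
      rw [← Finset.sum_add_distrib]
      refine Finset.sum_congr rfl (fun k _ => ?_)
      simp only [hγ, hrev1, hrev2, hα k]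
      ring
    rw [hsum]; exact add_pos h1 h2
  -- Step B: the middle weights are positive.
  have hγ1 : ∀ k, 0 < γ k 1 := by
    intro k
    have hk := H' (fun j => if j = k then 1 else 0) (fun _ => 1) (fun j => if j = k then 1 else 2)
      (Finset.sum_congr rfl (fun j _ => by by_cases hj : j = k <;> simp [hj]))
      ⟨k, Or.inl (by simp)⟩
    rw [Finset.sum_eq_single k (fun j _ hj => by simp [hj, hγ0 j]) (by simp)] at hk
    simp only [if_true, hγ2 k] at hk
    linarith
  -- Step C: injectivity.
  intro c c' hcc'
  dsimp only at hcc'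
  by_contra hne
  obtain ⟨k₀, hk₀⟩ := Function.ne_iff.mp hne
  set d : Fin N → ℤ := fun j => ((c j).val : ℤ) - (c' j).val with hd
  have hdlo : ∀ j, -3 ≤ d j := by intro j; have := (c' j).isLt; simp only [hd]; omega
  have hdhi : ∀ j, d j ≤ 3 := by intro j; have := (c j).isLt; simp only [hd]; omega
  have hd0 : d k₀ ≠ 0 := by
    intro h0
    apply hk₀; apply Fin.ext
    have : ((c k₀).val : ℤ) = (c' k₀).val := by simp only [hd] at h0; linarith
    exact_mod_cast this
  have hdsum : (∑ j, d j • lam j) = 0 := by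
    simp only [hd, sub_smul, Finset.sum_sub_distrib]
    rw [hcc']; exact sub_self _
  have hk := H' (fun j => (apPat (d j)).1) (fun j => (apPat (d j)).2.1) (fun j => (apPat (d j)).2.2)
    (by
      have step : ∀ j, ((((apPat (d j)).1).val : ℤ) + ((apPat (d j)).2.1).val +
          ((apPat (d j)).2.2).val) • lam j = (3 : ℤ) • lam j + d j • lam j := by
        intro j; rw [apPat_sum (d j) (hdlo j) (hdhi j), add_smul]
      rw [Finset.sum_congr rfl (fun j _ => step j), Finset.sum_add_distrib, hdsum, add_zero])
    ⟨k₀, apPat_not_distinct (d k₀) hd0⟩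
  have hle : (∑ j, (γ j (apPat (d j)).1 + γ j (apPat (d j)).2.1 + γ j (apPat (d j)).2.2 -
      (γ j 1 + γ j 2))) ≤ 0 :=
    Finset.sum_nonpos (fun j _ => apPat_excess_nonpos (d j) (γ j) (hγ0 j) (hγ2 j) (hγ1 j))
  exact absurd hk (not_lt.mpr hle)

/-- **AP digit designs of `cw₂^{⊠N}` need `|B| ≥ 4^N`.** -/
theorem four_pow_le_card_of_apDigits [Fintype B] (lam : Fin N → B) (α : Fin N → Fin 3 → ℝ)
    (hα : ∀ k, α k 0 = 0)
    (H : ∀ u v w : Fin N → Fin 3,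
      (∑ k, (((u k).val : ℤ) + (v k).val + (w k).val) • lam k) = ∑ k, (3 : ℤ) • lam k →
      (∃ k, u k = v k ∨ v k = w k ∨ u k = w k) →
      0 < ∑ k, (α k (u k) + α k (v k) + α k (w k) - (α k 1 + α k 2))) :
    4 ^ N ≤ Fintype.card B := by
  classical
  have h := Fintype.card_le_of_injective _ (apDigits_injective lam α hα H)
  simpa [Fintype.card_fun, Fintype.card_fin] using h

/-- **Non-vacuity and tightness at `N = 1`.**  The base case `ℤ/4` with digits `{0,1,2}`
(`λ = 1`) and weights `(0, ½, 0)` (Alman–Vassilevska Williams, arXiv:1810.08671, Thm. 7.2)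
satisfies hypothesis `H` of `apDigits_injective`; there `4^N = |B|`. -/
theorem apDigits_hypothesis_zmod_four : ∀ u v w : Fin 1 → Fin 3,
    (∑ k, (((u k).val : ℤ) + (v k).val + (w k).val) • (fun _ : Fin 1 => (1 : ZMod 4)) k) =
      ∑ k, (3 : ℤ) • (fun _ : Fin 1 => (1 : ZMod 4)) k →
    (∃ k, u k = v k ∨ v k = w k ∨ u k = w k) →
    0 < ∑ k, ((fun (_ : Fin 1) (t : Fin 3) => if t = 1 then (1/2 : ℝ) else 0) k (u k) +
      (fun (_ : Fin 1) (t : Fin 3) => if t = 1 then (1/2 : ℝ) else 0) k (v k) +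
      (fun (_ : Fin 1) (t : Fin 3) => if t = 1 then (1/2 : ℝ) else 0) k (w k) -
      ((fun (_ : Fin 1) (t : Fin 3) => if t = 1 then (1/2 : ℝ) else 0) k 1 +
       (fun (_ : Fin 1) (t : Fin 3) => if t = 1 then (1/2 : ℝ) else 0) k 2)) := by
  intro u v w hyp hns
  obtain ⟨k, hk⟩ := hns
  have hk0 : k = 0 := Subsingleton.elim _ _
  subst hk0
  simp only [Fin.sum_univ_one] at hyp ⊢
  generalize hua : u 0 = a at *
  generalize hvb : v 0 = b at *
  generalize hwc : w 0 = c at *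
  fin_cases a <;> fin_cases b <;> fin_cases c <;> simp_all
  all_goals revert hyp; decide

/-- The pipeline on the base case: `4 ^ 1 ≤ |ℤ/4|` through `four_pow_le_card_of_apDigits`. -/
theorem four_pow_one_le_card_zmod_four : 4 ^ 1 ≤ Fintype.card (ZMod 4) :=
  four_pow_le_card_of_apDigits (fun _ : Fin 1 => (1 : ZMod 4))
    (fun (_ : Fin 1) (t : Fin 3) => if t = 1 then (1/2 : ℝ) else 0) (fun _ => by simp)
    apDigits_hypothesis_zmod_four

end CwTwoAPDigits

end Summit.MatrixMultiplication.MatrixMultiplication.Theorems
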